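import Summits.AnomalousDissipation.AnomalousDissipation.Theses.WindLine
import Summits.AnomalousDissipation.AnomalousDissipation.Theorems.WindLineWindLineReachesCalmContinuation
import Summits.AnomalousDissipation.AnomalousDissipation.Theorems.WindLineWindLineReachesCalmEnergy
import Summits.AnomalousDissipation.AnomalousDissipation.Theorems.WindLineWindLineReachesCalmShore

/-!
# Route WindLine — support item `WindLineReachesCalm` (stmt-AnomalousDissipation-11420): proof

At fixed `ν > 0` and resolution `N` (`S = freqBall N`, mean mode included), for a real solenoidal force
vector `g` without mean mode and a non-resonant wind direction `e`, let
`V = {c ∈ galerkinSubspace S : c 0 ∈ ℝ e, galerkinRHS S ν g c = 0}` be the windy steady Galerkin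
variety. If the connected component of `c` in `V` reaches arbitrarily large wind `s` (`c 0 = s e`), then it
reaches arbitrarily negative wind and contains a CALM steady state (`c 0 = 0`).

## Proof (Browder continuation along the wind; the regular-value hypothesis of the item is not needed)

* A-priori bound (`…Energy`): every `c ∈ V` has wake `‖c_k‖ ≤ ρ = ‖g‖₂/(4π²ν)`, `k ≠ 0`, whatever its wind;
  and the Galerkin field restricted to the calm directions is COERCIVE off the `ρ`-ball, uniformly in `s`.
* Uniqueness at large wind (`…Shore`): for `s ≥ s₁` the slice `V ∩ {wind = s}` has at most one point.
* Continuation (`…Continuation`, from the tree's Browder theorem): for every `Λ` the zero set of the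
  parametrised calm field `(s, x) ↦ galerkinRHS S ν g (x + s ê)` over `s ∈ [-Λ, Λ]` contains a CONNECTED
  set `K_Λ ⊆ V` whose wind-projection is all of `[-Λ, Λ]`.
* For `Λ ≥ max(s₁, wind(c), 0)`: the component `C` of `c` reaches some wind `≥ Λ`, hence (intermediate
  value theorem along the connected `C`) contains a point of wind exactly `Λ`, which by uniqueness is THE
  point of `K_Λ` at wind `Λ`; so `K_Λ ⊆ C`, and `C` contains points of wind `-Λ` and of wind `0`.

Main results: `windLine_reaches_calm` (general finite symmetric `S ∋ 0`, any dimension) and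
`Summit.AnomalousDissipation.AnomalousDissipation.Theorems.windLineReachesCalm_proof : WindLineReachesCalm`.
Sources: F. E. Browder (1960) / Solan–Solan (2023) (tree: `BrowderContinuation`); Temam 1979, Ch. II (1.29)–(1.30);
the route card P1(b) (FoiasTemam1977 / TemamNSNFA1995 Thm 10.4 run along the wind instead of the force).
-/

-- `Summit.<Summit>.<Problem>` is the tree's mandated summit-side namespace (CONVENTIONS §2); for this
-- single-conjunct summit the two coincide, so the duplicate is deliberate.
set_option linter.dupNamespace false

noncomputable section

open scoped BigOperators InnerProductSpace ComplexConjugate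
open Set Function

namespace Summit.AnomalousDissipation.AnomalousDissipation.Theorems.WindLineReachesCalm

open Literature.Analysis.FunctionSpaces Literature.Analysis.FunctionSpaces.Torus
open Literature.Analysis.FluidPDE Literature.Analysis.FluidPDE.Torus

variable {d : Type*} [Fintype d] {S : Finset (d → ℤ)}

/-! ## §1 The windy phase space -/

omit [Fintype d] in
/-- A predicate on the frequencies of `S` holds "at every `k` with `k = 0`" iff it holds at the mean
mode `⟨0, h0⟩`. [folklore] -/
theorem forall_coe_eq_zero_iff (h0 : (0 : d → ℤ) ∈ S) {P : ↥S → Prop} :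
    (∀ k : ↥S, (k : d → ℤ) = 0 → P k) ↔ P ⟨0, h0⟩ := by
  constructor
  · intro h
    exact h ⟨0, h0⟩ rfl
  · intro h k hk
    have : k = ⟨0, h0⟩ := Subtype.ext hk
    subst this
    exact h

omit [Fintype d] in
/-- Real scalars act on `ℂ^d` through `ℝ ⊆ ℂ`. [folklore] -/
theorem real_smul_eq_coe_smul (a : ℝ) (x : EuclideanSpace ℂ d) : a • x = (a : ℂ) • x := by
  ext i
  simp only [PiLp.smul_apply, Complex.real_smul, smul_eq_mul]

/-- **The wind direction vector lies in the phase space**: the coefficient vector `ê = δ₀ ⊗ e_ℂ`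
(complexified `e` on the mean mode, zero elsewhere) is real and solenoidal. [folklore] -/
theorem single_complexify_mem_galerkinSubspace (h0 : (0 : d → ℤ) ∈ S) (e : EuclideanSpace ℝ d) :
    (Pi.single (⟨0, h0⟩ : ↥S) (EuclideanSpace.complexify e) : ↥S → EuclideanSpace ℂ d) ∈
      galerkinSubspace S := by
  classical
  refine ⟨?_, ?_⟩
  · intro k l hkl
    by_cases hk : k = ⟨0, h0⟩
    · subst hk
      have hl : l = ⟨0, h0⟩ := Subtype.ext (by simpa using hkl)
      subst hl
      rw [Pi.single_eq_same, EuclideanSpace.conjVec_complexify]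
    · have hk0 : (k : d → ℤ) ≠ 0 := fun h => hk (Subtype.ext h)
      have hl : l ≠ ⟨0, h0⟩ := by
        intro h
        subst h
        exact hk0 (neg_eq_zero.1 hkl.symm)
      rw [Pi.single_eq_of_ne hl, Pi.single_eq_of_ne hk, EuclideanSpace.conjVec_zero]
  · intro k
    by_cases hk : k = ⟨0, h0⟩
    · subst hk
      simp
    · rw [Pi.single_eq_of_ne hk]
      simp

/-- **The wind coordinate.** For `e ≠ 0` there is a continuous functional `σ` on coefficient vectors
reading off the wind: `σ c = s` whenever `c 0 = s e_ℂ` (`σ c = Re⟪e_ℂ, c 0⟫ / ‖e‖²`). [folklore] -/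
theorem exists_windCoordinate (h0 : (0 : d → ℤ) ∈ S) {e : EuclideanSpace ℝ d} (he : e ≠ 0) :
    ∃ σ : (↥S → EuclideanSpace ℂ d) → ℝ, Continuous σ ∧
      ∀ (c : ↥S → EuclideanSpace ℂ d) (s : ℝ),
        c ⟨0, h0⟩ = (s : ℂ) • EuclideanSpace.complexify e → σ c = s := by
  have hne : ‖e‖ ^ 2 ≠ 0 := pow_ne_zero 2 (norm_ne_zero_iff.2 he)
  refine ⟨fun c => (inner ℂ (EuclideanSpace.complexify e) (c ⟨0, h0⟩)).re / ‖e‖ ^ 2, ?_, ?_⟩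
  · refine Continuous.div_const (Complex.continuous_re.comp ?_) _
    exact Continuous.inner continuous_const (continuous_apply _)
  · intro c s hc
    dsimp only
    have h2 : (inner ℂ (EuclideanSpace.complexify e) (EuclideanSpace.complexify e)).re = ‖e‖ ^ 2 := by
      rw [← RCLike.re_to_complex, inner_self_eq_norm_sq, EuclideanSpace.norm_complexify]
    rw [hc, inner_smul_right, Complex.re_ofReal_mul, h2, mul_div_assoc, div_self hne, mul_one]

/-! ## §2 The theorem on a general symmetric frequency set -/

/-- **The wind-line reaches the calm slice** (general form of `WindLineReachesCalm`). Let `S` be a finite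
symmetric frequency set containing the mean mode, `g ∈ galerkinSubspace S` a force without mean mode,
`e` non-resonant on `S ∖ 0`, `ν > 0`, and `V` the windy steady Galerkin variety
`{c ∈ galerkinSubspace S : c 0 ∈ ℝ e_ℂ, galerkinRHS S ν g c = 0}`. If the connected component in `V` of
`c ∈ V` reaches arbitrarily large wind, then it reaches arbitrarily negative wind and contains a calm
steady state. Browder continuation along the wind on slabs `|s| ≤ Λ` (a-priori bound from the energy
identity) + uniqueness of windy states at large wind + the intermediate value theorem; see the module
docstring. [folklore] -/
theorem windLine_reaches_calm (hS : ∀ k ∈ S, -k ∈ S) (h0 : (0 : d → ℤ) ∈ S)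
    {g : ↥S → EuclideanSpace ℂ d} (hg : g ∈ galerkinSubspace S) (hg0 : g ⟨0, h0⟩ = 0)
    {e : EuclideanSpace ℝ d} (he : ∀ k : ↥S, (k : d → ℤ) ≠ 0 → ∑ i, e i * ((k : d → ℤ) i : ℝ) ≠ 0)
    {ν : ℝ} (hν : 0 < ν) {V : Set (↥S → EuclideanSpace ℂ d)}
    (hV : V = {c | c ∈ galerkinSubspace S ∧
      (∃ s : ℝ, ∀ k : ↥S, (k : d → ℤ) = 0 → c k = (s : ℂ) • EuclideanSpace.complexify e) ∧
      galerkinRHS S ν g c = 0})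
    {c : ↥S → EuclideanSpace ℂ d} (hc : c ∈ V)
    (hplus : ∀ Λ : ℝ, ∃ c' ∈ connectedComponentIn V c, ∃ s : ℝ,
      (∀ k : ↥S, (k : d → ℤ) = 0 → c' k = (s : ℂ) • EuclideanSpace.complexify e) ∧ Λ ≤ s) :
    (∀ Λ : ℝ, ∃ c' ∈ connectedComponentIn V c, ∃ s : ℝ,
      (∀ k : ↥S, (k : d → ℤ) = 0 → c' k = (s : ℂ) • EuclideanSpace.complexify e) ∧ s ≤ -Λ) ∧
    ∃ c' ∈ connectedComponentIn V c, ∀ k : ↥S, (k : d → ℤ) = 0 → c' k = 0 := by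
  classical
  set E : EuclideanSpace ℂ d := EuclideanSpace.complexify e with hE
  have hVmem : ∀ x, x ∈ V ↔ x ∈ galerkinSubspace S ∧
      (∃ s : ℝ, x ⟨0, h0⟩ = (s : ℂ) • E) ∧ galerkinRHS S ν g x = 0 := by
    intro x
    rw [hV, mem_setOf_eq]
    simp only [forall_coe_eq_zero_iff h0]
  have hcV := hc
  obtain ⟨hcY, ⟨s₀, hcs₀⟩, hcz⟩ := (hVmem c).1 hc
  -- the degenerate direction `e = 0`: the wind coordinate is mute, `c` itself is calm
  by_cases he0 : e = 0
  · have hE0 : E = 0 := by rw [hE, he0, map_zero]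
    have hc0 : c ⟨0, h0⟩ = 0 := by rw [hcs₀, hE0, smul_zero]
    refine ⟨fun Λ => ⟨c, mem_connectedComponentIn hcV, -Λ, (forall_coe_eq_zero_iff h0).2 ?_, le_rfl⟩,
      c, mem_connectedComponentIn hcV, (forall_coe_eq_zero_iff h0).2 hc0⟩
    rw [hc0, hE0, smul_zero]
  -- the wind coordinate
  obtain ⟨σ, hσc, hσ⟩ := exists_windCoordinate h0 he0
  have hσV : ∀ x ∈ V, x ⟨0, h0⟩ = (σ x : ℂ) • E := by
    intro x hx
    obtain ⟨-, ⟨s, hs⟩, -⟩ := (hVmem x).1 hx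
    rw [hσ x s hs, hs]
  -- a-priori bound on the wakes of windy steady states
  set ρ : ℝ := Real.sqrt (∑ k : ↥S, ‖g k‖ ^ 2) / (4 * Real.pi ^ 2 * ν) with hρ
  have hρ0 : 0 ≤ ρ := by positivity
  have hbound : ∀ x ∈ V, ∀ k : ↥S, (k : d → ℤ) ≠ 0 → ‖x k‖ ≤ ρ := by
    intro x hx k hk
    obtain ⟨hxY, -, hxz⟩ := (hVmem x).1 hx
    exact norm_apply_le_of_galerkinRHS_eq_zero hν hS h0 hg.1 hg0 hxY hxz hk
  -- uniqueness at large wind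
  obtain ⟨s₁, hs₁⟩ := eq_of_galerkinRHS_eq_of_wind_ge h0 e he hρ0
  have huniq : ∀ x ∈ V, ∀ y ∈ V, s₁ ≤ |σ x| → σ x = σ y → x = y := by
    intro x hx y hy hsx hxy
    obtain ⟨hxY, -, hxz⟩ := (hVmem x).1 hx
    obtain ⟨hyY, -, hyz⟩ := (hVmem y).1 hy
    refine hs₁ ν g (σ x) hsx x y hxY.2 hyY.2 (hσV x hx) ?_ (hbound x hx) (hbound y hy) ?_
    · rw [hxy]; exact hσV y hy
    · rw [hxz, hyz]
  -- the calm subspace `W`, its `ℓ²` form, and the wind direction vector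
  set Y := galerkinSubspace S with hY
  set W : Submodule ℝ (↥S → EuclideanSpace ℂ d) :=
    Y ⊓ LinearMap.ker (LinearMap.proj (⟨0, h0⟩ : ↥S) :
      (↥S → EuclideanSpace ℂ d) →ₗ[ℝ] EuclideanSpace ℂ d) with hW
  have hWmem : ∀ x, x ∈ W ↔ x ∈ Y ∧ x ⟨0, h0⟩ = 0 := by
    intro x
    rw [hW, Submodule.mem_inf, LinearMap.mem_ker, LinearMap.proj_apply]
  obtain ⟨B₀, hB₀⟩ : ∃ B₀ : (↥S → EuclideanSpace ℂ d) →ₗ[ℝ] (↥S → EuclideanSpace ℂ d) →ₗ[ℝ] ℝ,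
      ∀ x y, B₀ x y = ∑ k : ↥S, (inner ℂ (x k) (y k)).re :=
    ⟨LinearMap.mk₂ ℝ (fun x y => ∑ k : ↥S, (inner ℂ (x k) (y k)).re)
      (fun x₁ x₂ y => by
        simp only [Pi.add_apply, inner_add_left, Complex.add_re, Finset.sum_add_distrib])
      (fun a x y => by
        simp only [Pi.smul_apply, real_smul_eq_coe_smul, inner_smul_left, Complex.conj_ofReal,
          Complex.re_ofReal_mul, Finset.mul_sum, smul_eq_mul])
      (fun x y₁ y₂ => by
        simp only [Pi.add_apply, inner_add_right, Complex.add_re, Finset.sum_add_distrib])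
      (fun a x y => by
        simp only [Pi.smul_apply, real_smul_eq_coe_smul, inner_smul_right, Complex.re_ofReal_mul,
          Finset.mul_sum, smul_eq_mul]),
      fun _ _ => rfl⟩
  obtain ⟨B, hB_apply⟩ : ∃ B : W →ₗ[ℝ] W →ₗ[ℝ] ℝ, ∀ x y : W, B x y =
      ∑ k : ↥S, (inner ℂ ((x : ↥S → EuclideanSpace ℂ d) k) ((y : ↥S → EuclideanSpace ℂ d) k)).re :=
    ⟨B₀.compl₁₂ W.subtype W.subtype, fun x y => hB₀ _ _⟩
  have hB_self : ∀ x : W, B x x = ∑ k : ↥S, ‖(x : ↥S → EuclideanSpace ℂ d) k‖ ^ 2 := by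
    intro x
    rw [hB_apply]
    refine Finset.sum_congr rfl fun k _ => ?_
    rw [← RCLike.re_to_complex, inner_self_eq_norm_sq]
  have hB_pos : ∀ x : W, x ≠ 0 → 0 < B x x := by
    intro x hx
    rw [hB_self]
    have hx' : (x : ↥S → EuclideanSpace ℂ d) ≠ 0 := fun h => hx (Subtype.ext h)
    obtain ⟨k, hk⟩ : ∃ k, (x : ↥S → EuclideanSpace ℂ d) k ≠ 0 := Function.ne_iff.1 hx'
    exact lt_of_lt_of_le (pow_pos (norm_pos_iff.2 hk) 2)
      (Finset.single_le_sum (f := fun k => ‖(x : ↥S → EuclideanSpace ℂ d) k‖ ^ 2)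
        (fun k _ => sq_nonneg _) (Finset.mem_univ k))
  set eh : ↥S → EuclideanSpace ℂ d := Pi.single (⟨0, h0⟩ : ↥S) E with heh
  have hehY : eh ∈ Y := single_complexify_mem_galerkinSubspace h0 e
  -- the affine embedding of `ℝ × W` onto the windy phase space
  set emb : ℝ → W → (↥S → EuclideanSpace ℂ d) := fun s x => (x : ↥S → EuclideanSpace ℂ d) + s • eh
    with hemb
  have hembY : ∀ s x, emb s x ∈ Y := fun s x => Y.add_mem ((hWmem x).1 x.2).1 (Y.smul_mem s hehY)
  have hemb0 : ∀ s x, emb s x ⟨0, h0⟩ = (s : ℂ) • E := by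
    intro s x
    rw [hemb]
    dsimp only
    rw [Pi.add_apply, ((hWmem x).1 x.2).2, zero_add, Pi.smul_apply, heh, Pi.single_eq_same,
      real_smul_eq_coe_smul]
  have hemb_ne : ∀ s x (k : ↥S), (k : d → ℤ) ≠ 0 → emb s x k = (x : ↥S → EuclideanSpace ℂ d) k := by
    intro s x k hk
    have hk' : k ≠ ⟨0, h0⟩ := fun h => hk (by rw [h])
    rw [hemb]
    dsimp only
    rw [Pi.add_apply, Pi.smul_apply, heh, Pi.single_eq_of_ne hk', smul_zero, add_zero]
  have hembc : Continuous fun p : ℝ × W => emb p.1 p.2 :=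
    (continuous_subtype_val.comp continuous_snd).add (continuous_fst.smul continuous_const)
  have hembV : ∀ s x, galerkinRHS S ν g (emb s x) = 0 → emb s x ∈ V := fun s x hz =>
    (hVmem _).2 ⟨hembY s x, ⟨s, hemb0 s x⟩, hz⟩
  -- the parametrised calm field and its coercivity
  have hRHS_W : ∀ s x, galerkinRHS S ν g (emb s x) ∈ W := fun s x =>
    (hWmem _).2 ⟨galerkinRHS_mem ν hS hg.1 (hembY s x),
      galerkinRHS_apply_zero ν h0 hg0 (hembY s x).2⟩
  set Vf : ℝ → W → W := fun s x => ⟨galerkinRHS S ν g (emb s x), hRHS_W s x⟩ with hVf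
  have hVfc : Continuous fun p : ℝ × W => Vf p.1 p.2 :=
    Continuous.subtype_mk ((continuous_galerkinRHS ν).comp (continuous_const.prodMk hembc)) _
  have hcoer : ∀ (s : ℝ) (x : W), ρ ^ 2 ≤ B x x → B (Vf s x) x ≤ 0 := by
    intro s x hx
    have hsum : B (Vf s x) x = ∑ k : ↥S, (inner ℂ (emb s x k) (galerkinRHS S ν g (emb s x) k)).re := by
      rw [hB_apply]
      refine Finset.sum_congr rfl fun k _ => ?_
      by_cases hk : (k : d → ℤ) = 0
      · have hk' : k = ⟨0, h0⟩ := Subtype.ext hk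
        rw [hk']
        show (inner ℂ (galerkinRHS S ν g (emb s x) ⟨0, h0⟩) _).re = _
        rw [galerkinRHS_apply_zero ν h0 hg0 (hembY s x).2, inner_zero_left, inner_zero_right]
      · rw [← hemb_ne s x k hk, ← inner_conj_symm, Complex.conj_re]
    have hβ : ∑ k : ↥S, (if (k : d → ℤ) = 0 then 0 else ‖emb s x k‖ ^ 2) = B x x := by
      rw [hB_self]
      refine Finset.sum_congr rfl fun k _ => ?_
      split_ifs with hk
      · have hk' : k = ⟨0, h0⟩ := Subtype.ext hk
        rw [hk', ((hWmem x).1 x.2).2, norm_zero]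
        ring
      · rw [hemb_ne s x k hk]
    have hle := sum_re_inner_galerkinRHS_le hν.le hS h0 hg.1 hg0 (hembY s x)
    rw [hβ, ← hsum] at hle
    -- `√(B x x) ≥ ρ = ‖g‖₂ / (4π²ν)`, so the right-hand side is `≤ 0`
    have hb0 : 0 ≤ B x x := (sq_nonneg ρ).trans hx
    have hsq : ρ ≤ Real.sqrt (B x x) := by
      rw [← Real.sqrt_sq hρ0]
      exact Real.sqrt_le_sqrt hx
    have hγ : Real.sqrt (∑ k : ↥S, ‖g k‖ ^ 2) = 4 * Real.pi ^ 2 * ν * ρ := by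
      rw [hρ]
      field_simp
    rw [hγ] at hle
    have h1 : 4 * Real.pi ^ 2 * ν * ρ * Real.sqrt (B x x) ≤
        4 * Real.pi ^ 2 * ν * (Real.sqrt (B x x) * Real.sqrt (B x x)) := by
      rw [mul_assoc]
      exact mul_le_mul_of_nonneg_left (mul_le_mul_of_nonneg_right hsq (Real.sqrt_nonneg _))
        (by positivity)
    rw [Real.mul_self_sqrt hb0] at h1
    linarith
  -- Browder continuation at level `Λ`, transported into `V`
  have key : ∀ Λ : ℝ, 0 ≤ Λ → s₁ ≤ Λ → σ c ≤ Λ →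
      (∃ q ∈ connectedComponentIn V c, σ q = -Λ) ∧ ∃ o ∈ connectedComponentIn V c, σ o = 0 := by
    intro Λ hΛ0 hΛ1 hΛc
    have hab : -Λ ≤ Λ := by linarith
    obtain ⟨K, hK, hKconn, hKproj⟩ := exists_isConnected_zeros_of_bilin_coercive B hB_pos hVfc hab
      (fun s _ x hx => hcoer s x hx)
    set θ : ℝ × W → (↥S → EuclideanSpace ℂ d) := fun p => emb p.1 p.2 with hθ
    have hθV : ∀ p ∈ K, θ p ∈ V := by
      intro p hp
      obtain ⟨-, hz⟩ := hK hp
      exact hembV p.1 p.2 (congrArg Subtype.val hz)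
    have hθσ : ∀ p ∈ K, σ (θ p) = p.1 := fun p _ => hσ _ _ (hemb0 p.1 p.2)
    have hK'conn : IsPreconnected (θ '' K) := (hKconn.image θ hembc.continuousOn).isPreconnected
    have hK'V : θ '' K ⊆ V := by
      rintro _ ⟨p, hp, rfl⟩
      exact hθV p hp
    -- points of `K` at winds `Λ`, `-Λ`, `0`
    have hpt : ∀ t ∈ Icc (-Λ) Λ, ∃ p ∈ K, p.1 = t := by
      intro t ht
      rw [← hKproj] at ht
      obtain ⟨p, hp, rfl⟩ := ht
      exact ⟨p, hp, rfl⟩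
    obtain ⟨pΛ, hpΛ, hpΛ1⟩ := hpt Λ ⟨hab, le_rfl⟩
    obtain ⟨pn, hpn, hpn1⟩ := hpt (-Λ) ⟨le_rfl, hab⟩
    obtain ⟨p0, hp0, hp01⟩ := hpt 0 ⟨by linarith, hΛ0⟩
    -- the component of `c` contains a point of wind exactly `Λ` (intermediate value theorem)
    obtain ⟨c₁, hc₁, s, hc₁s, hΛs⟩ := hplus Λ
    have hc₁V : c₁ ∈ V := connectedComponentIn_subset _ _ hc₁
    have hσc₁ : σ c₁ = s := hσ c₁ s ((forall_coe_eq_zero_iff h0).1 hc₁s)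
    have hIVT : Λ ∈ σ '' connectedComponentIn V c := by
      have hpre : IsPreconnected (σ '' connectedComponentIn V c) :=
        isPreconnected_connectedComponentIn.image σ hσc.continuousOn
      refine hpre.Icc_subset (mem_image_of_mem σ (mem_connectedComponentIn hcV))
        (mem_image_of_mem σ hc₁) ⟨hΛc, ?_⟩
      rw [hσc₁]
      exact hΛs
    obtain ⟨c₂, hc₂, hσc₂⟩ := hIVT
    have hc₂V : c₂ ∈ V := connectedComponentIn_subset _ _ hc₂
    -- by uniqueness at wind `Λ ≥ s₁` it is the point of `K` at wind `Λ`
    have heq : c₂ = θ pΛ := by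
      refine huniq c₂ hc₂V (θ pΛ) (hθV pΛ hpΛ) ?_ ?_
      · rw [hσc₂, abs_of_nonneg hΛ0]
        exact hΛ1
      · rw [hσc₂, hθσ pΛ hpΛ, hpΛ1]
    -- hence the whole connected set `θ '' K` lies in the component of `c`
    have hsub : θ '' K ⊆ connectedComponentIn V c := by
      have h1 : θ '' K ⊆ connectedComponentIn V (θ pΛ) :=
        hK'conn.subset_connectedComponentIn (mem_image_of_mem θ hpΛ) hK'V
      rw [connectedComponentIn_eq hc₂, heq]
      exact h1
    refine ⟨⟨θ pn, hsub (mem_image_of_mem θ hpn), ?_⟩, θ p0, hsub (mem_image_of_mem θ hp0), ?_⟩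
    · rw [hθσ pn hpn, hpn1]
    · rw [hθσ p0 hp0, hp01]
  -- conclusion
  refine ⟨fun Λ => ?_, ?_⟩
  · set Λ' : ℝ := max Λ (max 0 (max s₁ (σ c))) with hΛ'
    obtain ⟨⟨q, hq, hσq⟩, -⟩ := key Λ' (by simp [hΛ']) (by simp [hΛ']) (by simp [hΛ'])
    refine ⟨q, hq, σ q, (forall_coe_eq_zero_iff h0).2 (hσV q (connectedComponentIn_subset _ _ hq)), ?_⟩
    rw [hσq, neg_le_neg_iff]
    exact le_max_left _ _
  · set Λ' : ℝ := max 0 (max s₁ (σ c)) with hΛ'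
    obtain ⟨-, o, ho, hσo⟩ := key Λ' (by simp [hΛ']) (by simp [hΛ']) (by simp [hΛ'])
    refine ⟨o, ho, (forall_coe_eq_zero_iff h0).2 ?_⟩
    rw [hσV o (connectedComponentIn_subset _ _ ho), hσo, Complex.ofReal_zero, zero_smul]

end Summit.AnomalousDissipation.AnomalousDissipation.Theorems.WindLineReachesCalm

/-! ## §3 The route item -/

namespace Summit.AnomalousDissipation.AnomalousDissipation.Theorems

open Literature.Analysis.FunctionSpaces Literature.Analysis.FunctionSpaces.Torus
open Summit.AnomalousDissipation.AnomalousDissipation.Theorems.WindLineReachesCalm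

/-- **`WindLine.WindLineReachesCalm` holds** (item stmt-AnomalousDissipation-11420): at fixed `ν > 0` and
resolution `N`, for a real solenoidal force vector `g` without mean mode and a non-resonant direction `e`,
every point of the windy steady Galerkin variety `V` whose connected component in `V` reaches arbitrarily
large wind `s` has a component that also reaches arbitrarily negative wind and contains a calm steady
state (`c 0 = 0`). The regular-value hypothesis of the item is not used. Browder continuation along the
wind (energy a-priori bound, large-wind uniqueness, intermediate value theorem). [folklore] -/
theorem windLineReachesCalm_proof :
    Summit.AnomalousDissipation.AnomalousDissipation.Theses.WindLine.WindLineReachesCalm := by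
  unfold Summit.AnomalousDissipation.AnomalousDissipation.Theses.WindLine.WindLineReachesCalm
  intro N S hS g hg hg0 e he ν hν V hV _hreg c hc hplus
  have hSsym : ∀ k ∈ S, -k ∈ S := by
    subst hS
    exact neg_mem_freqBall_of_mem
  have h0 : (0 : Fin 3 → ℤ) ∈ S := by
    subst hS
    exact zero_mem_freqBall N
  exact windLine_reaches_calm hSsym h0 hg (hg0 ⟨0, h0⟩ rfl) he hν hV hc hplus

end Summit.AnomalousDissipation.AnomalousDissipation.Theorems

end
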